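import Summits.HodgeConjecture.CorCM.GaloisNonNormalPrimeOrder
import Summits.HodgeConjecture.CorCM.GaloisSkewSectionPrimeOrbits
import Summits.HodgeConjecture.CorCM.GaloisSkewCountPrimeOrbits
import HarnessLib

/-!
# A NON-NORMAL SUBGROUP OF PRIME ORDER MAKES THE FIELD BAD — REFINED THRESHOLDS: `|Gal| ≥ 44` (`p = 2`), `78` (`p = 3`), `150`
# (`p = 5`), `210` (`p = 7`); GOOD Galois CM fields of those degrees have their involutions central and their subgroups of
# order `3, 5, 7` normal

COR-CM (cell `pub-hodgecm2`), binder seat b04 (gen 39), count-neutral own lane «Galois-CM-type classification».  KERNEL ONLY: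
theorems; no definition, no named fact, no `sorry`.  `HC_CM` is neither used nor claimed.  Galois dress of the refined skew-section
theorem `SkewSectionPrime.exists_skew_of_nonnormal_prime_order'` (`CorCM/GaloisSkewSectionPrimeOrbits`) with the exact thresholds of
`CorCM/GaloisSkewCountPrimeOrbits`; gen 33's file `CorCM/GaloisNonNormalPrimeOrder` is the same dress of the coarser count
(thresholds `52, 84, 170, 238`).

As in gen 33: «BAD» = a PRIMITIVE DEGENERATE CM type = a simple abelian variety of dimension `[K:ℚ]/2` with CM by `K` carrying a
rational `(q,q)` class outside the divisor ring on some power (gen 23's `GaloisModels.exists_simple_degenerate_of_model_skew` reads a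
skew CM set — trivial left stabiliser, right stabiliser `⊇ ⟨u⟩` — by such a type).  NEW ROWS: every order-`48` group with a
non-central involution (gen 33 needed three conjugates there: `GL(2,3)`, `SL(2,3)∘C₄`, …, now uniform), orders `44`; `78`; `150, 160`;
`182, 210, 224`; and the two inputs `160 = 32·5`, `224 = 32·7` of the degree-`32·p` structure theorem
(`CorCM/GaloisThirtyTwoTimesOddPrimeStructure`, gen 39).

* §1 model forms: `exists_simple_degenerate_of_nonnormal_prime_order'` (refined raw count), `…_of_prime_order_family'`,
  `…_of_noncentral_involution_of_card_ge'` (`|G₀| ≥ 44`), `…_of_nonnormal_order_three'` (`|G₀| ≥ 78`),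
  **`…_of_nonnormal_order_five`** (`|G₀| ≥ 150`), **`…_of_nonnormal_order_seven`** (`|G₀| ≥ 210`).
* §2 on `Gal(K/ℚ)`: `exists_simple_degenerate_of_nonnormal_prime_order_gal'` (refined count), `…_of_card_ge_gal` (one statement for
  `p ∈ {2, 3, 5, 7}` from `[K:ℚ] ≥ 44 / 78 / 150 / 210`).
* §3 GOOD ⟹ NORMAL: `exists_conj_eq_pow_of_forall_isNondegenerate'` (refined count), **`exists_conj_eq_pow_of_forall_isNondegenerate_of_card_ge`**
  (`p ∈ {2,3,5,7}`), `commute_of_involution_of_forall_isNondegenerate_of_card_ge` (`[K:ℚ] ≥ 44`).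

## References

* [Shimura1998] G. Shimura, *Abelian Varieties with Complex Multiplication and Modular Functions*, §6.2 Thm. 3, §8.2 Prop. 26, §32.10.
* [Gordon1999HodgeAVSurvey] B. B. Gordon, *A survey of the Hodge conjecture for abelian varieties*, Thm. 6.4, §9.3.
* [Kubota1965] T. Kubota, *On the field extension by complex multiplication*, Trans. AMS 118 (1965), §2.
-/

noncomputable section

open CategoryTheory CategoryTheory.Limits NumberField
open scoped BigOperators

namespace Summit.HodgeConjecture.CorCM.GaloisModels

open Literature.NumberTheory.ComplexMultiplication
open Literature.AlgebraicGeometry.Motives (AbelianVariety CMType)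
open Literature.AlgebraicGeometry.HodgeTheory
open Literature.AlgebraicGeometry.ComplexMultiplication (IsCMTypeRealisation)
open Literature.AlgebraicGeometry.Pohlmann1968
open Literature.Barriers.HodgeConjecture (divisorClassesSpan)
open Summit.HodgeConjecture.CorCM.GaloisRank

variable {K : Type} [Field K] [NumberField K] [IsCMField K] [IsGalois ℚ K]

/-! ## §1 Model forms -/

/-- **A NON-NORMAL SUBGROUP OF PRIME ORDER MAKES THE FIELD BAD** (model form, REFINED raw count): `e : Gal(K/ℚ) ≃* G₀`, `|G₀| = 2pn`,
`uᵖ = 1 ≠ u`, `g u g⁻¹ ∉ ⟨u⟩` for some `g`, and `(2pn - 1 - m(p-1))·2^(n/2) + m(p-1)·2^((n + (p-1)(n/m))/p) < 2^n` for all `m ≥ 2`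
dividing `n` ⟹ `K` carries a SIMPLE DEGENERATE abelian variety of dimension `|G₀|/2` with CM by `K` and a rational `(q,q)` class
outside the divisor ring on some power. [cite: Shimura1998, §6.2 Thm. 3, §8.2 Prop. 26 and §32.10] [cite: Gordon1999HodgeAVSurvey, Thm. 6.4 and §9.3] -/
theorem exists_simple_degenerate_of_nonnormal_prime_order' {G₀ : Type*} [Group G₀] [Fintype G₀] [DecidableEq G₀]
    (e : (K ≃ₐ[ℚ] K) ≃* G₀) (u : G₀) (p n : ℕ) [Fact p.Prime] (hup : u ^ p = 1) (hu1 : u ≠ 1)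
    (hcard : Fintype.card G₀ = 2 * p * n) (hnn : ∃ g : G₀, ∀ k < p, g * u * g⁻¹ ≠ u ^ k)
    (hcount : ∀ m, 2 ≤ m → m ∣ n →
      (2 * p * n - 1 - m * (p - 1)) * 2 ^ (n / 2) + m * (p - 1) * 2 ^ ((n + (p - 1) * (n / m)) / p) < 2 ^ n) :
    ∃ (Φ : CMType K) (φ₀ : K →+* ℂ) (A : AbelianVariety ℂ) (ι : 𝓞 K →+* End A)
      (θ : K →+* Module.End ℂ (complexBetti A.X 1)),
      IsPrimitive (ℂ ≃+* ℂ) Φ.1 φ₀ ∧ ¬ IsNondegenerate Φ ∧ IsCMTypeRealisation Φ A ι θ ∧ A.IsSimple ∧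
      A.dim = Fintype.card G₀ / 2 ∧
      ∃ n p : ℕ, ∃ x : complexBetti (⨁ fun _ : Fin n => A).X (2 * p), IsRationalClass x ∧
        IsOfHodgeType (⨁ fun _ : Fin n => A).dim (⨁ fun _ : Fin n => A).X (2 * p) p p x ∧
        x ∉ divisorClassesSpan (⨁ fun _ : Fin n => A).X (⨁ fun _ : Fin n => A).dim p := by
  classical
  set c := e ((IsCMField.complexConj K).restrictScalars ℚ) with hc_def
  have hcc : c * c = 1 := model_complexConj_mul_self e rfl
  have hc1 : c ≠ 1 := model_complexConj_ne_one e rfl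
  have hcen : ∀ g : G₀, c * g = g * c := model_complexConj_comm e rfl
  obtain ⟨T, hcm, hprim, hTu⟩ := SkewSectionPrime.exists_skew_of_nonnormal_prime_order' c u p n hcc hc1 hcen hup hu1
    hcard hnn (by rw [hcard]; exact hcount)
  exact exists_simple_degenerate_of_model_skew e c rfl T hcm hprim hu1 hTu

/-- **… FAMILY form** (REFINED count): `m₀` exhibited conjugators `g_i` of `⟨u⟩` (`g_j⁻¹ g_i ∉ N(⟨u⟩)` for `i < j`), `c ∉ ⟨u⟩` on the
model's complex conjugation, and the refined count only for `m ≥ m₀` dividing `n`.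
[cite: Shimura1998, §6.2 Thm. 3, §8.2 Prop. 26 and §32.10] [cite: Gordon1999HodgeAVSurvey, Thm. 6.4 and §9.3] -/
theorem exists_simple_degenerate_of_prime_order_family' {G₀ : Type*} [Group G₀] [Fintype G₀] [DecidableEq G₀]
    (e : (K ≃ₐ[ℚ] K) ≃* G₀) (u : G₀) (p n m₀ : ℕ) [Fact p.Prime] (hup : u ^ p = 1) (hu1 : u ≠ 1)
    (hcU : ∀ j < p, e ((IsCMField.complexConj K).restrictScalars ℚ) ≠ u ^ j)
    (hcard : Fintype.card G₀ = 2 * p * n) (g : Fin m₀ → G₀)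
    (hind : ∀ i j : Fin m₀, i < j → ∀ k < p, ((g j)⁻¹ * g i) * u * ((g j)⁻¹ * g i)⁻¹ ≠ u ^ k)
    (hcount : ∀ m, m₀ ≤ m → m ∣ n →
      (2 * p * n - 1 - m * (p - 1)) * 2 ^ (n / 2) + m * (p - 1) * 2 ^ ((n + (p - 1) * (n / m)) / p) < 2 ^ n) :
    ∃ (Φ : CMType K) (φ₀ : K →+* ℂ) (A : AbelianVariety ℂ) (ι : 𝓞 K →+* End A)
      (θ : K →+* Module.End ℂ (complexBetti A.X 1)),
      IsPrimitive (ℂ ≃+* ℂ) Φ.1 φ₀ ∧ ¬ IsNondegenerate Φ ∧ IsCMTypeRealisation Φ A ι θ ∧ A.IsSimple ∧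
      A.dim = Fintype.card G₀ / 2 ∧
      ∃ n p : ℕ, ∃ x : complexBetti (⨁ fun _ : Fin n => A).X (2 * p), IsRationalClass x ∧
        IsOfHodgeType (⨁ fun _ : Fin n => A).dim (⨁ fun _ : Fin n => A).X (2 * p) p p x ∧
        x ∉ divisorClassesSpan (⨁ fun _ : Fin n => A).X (⨁ fun _ : Fin n => A).dim p := by
  classical
  set c := e ((IsCMField.complexConj K).restrictScalars ℚ) with hc_def
  have hcc : c * c = 1 := model_complexConj_mul_self e rfl
  have hcen : ∀ g : G₀, c * g = g * c := model_complexConj_comm e rfl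
  obtain ⟨T, hcm, hprim, hTu⟩ := SkewSectionPrime.exists_skew_of_prime_order_family' c u p n m₀ hcc hcen hup hu1 hcU hcard
    g hind (by rw [hcard]; exact hcount)
  exact exists_simple_degenerate_of_model_skew e c rfl T hcm hprim hu1 hTu

/-- **`p = 2`: a NON-CENTRAL INVOLUTION and `|G₀| ≥ 44`** ⟹ a simple DEGENERATE abelian variety of dimension `|G₀|/2` with CM by `K`
(gen 32: `64`; gen 33: `52`, and `48` only for three conjugates — the refined count makes `44` and `48` unconditional).
[cite: Shimura1998, §6.2 Thm. 3, §8.2 Prop. 26 and §32.10] [cite: Gordon1999HodgeAVSurvey, Thm. 6.4 and §9.3] -/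
theorem exists_simple_degenerate_of_noncentral_involution_of_card_ge' {G₀ : Type*} [Group G₀] [Fintype G₀] [DecidableEq G₀]
    (e : (K ≃ₐ[ℚ] K) ≃* G₀) (u : G₀) (huu : u * u = 1) (hnc : ∃ g : G₀, g * u ≠ u * g) (hbig : 44 ≤ Fintype.card G₀) :
    ∃ (Φ : CMType K) (φ₀ : K →+* ℂ) (A : AbelianVariety ℂ) (ι : 𝓞 K →+* End A)
      (θ : K →+* Module.End ℂ (complexBetti A.X 1)),
      IsPrimitive (ℂ ≃+* ℂ) Φ.1 φ₀ ∧ ¬ IsNondegenerate Φ ∧ IsCMTypeRealisation Φ A ι θ ∧ A.IsSimple ∧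
      A.dim = Fintype.card G₀ / 2 ∧
      ∃ n p : ℕ, ∃ x : complexBetti (⨁ fun _ : Fin n => A).X (2 * p), IsRationalClass x ∧
        IsOfHodgeType (⨁ fun _ : Fin n => A).dim (⨁ fun _ : Fin n => A).X (2 * p) p p x ∧
        x ∉ divisorClassesSpan (⨁ fun _ : Fin n => A).X (⨁ fun _ : Fin n => A).dim p := by
  classical
  set c := e ((IsCMField.complexConj K).restrictScalars ℚ) with hc_def
  have hcc : c * c = 1 := model_complexConj_mul_self e rfl
  have hc1 : c ≠ 1 := model_complexConj_ne_one e rfl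
  have hcen : ∀ g : G₀, c * g = g * c := model_complexConj_comm e rfl
  obtain ⟨g, hg⟩ := hnc
  have hu1 : u ≠ 1 := fun h => hg (by rw [h, mul_one, one_mul])
  have hu2 : u ^ 2 = 1 := by rw [pow_two, huu]
  have hnn : ∃ g : G₀, ∀ k < 2, g * u * g⁻¹ ≠ u ^ k := by
    refine ⟨g, fun k hk h => ?_⟩
    interval_cases k
    · rw [pow_zero] at h
      exact hu1 (by have := congrArg (fun x => g⁻¹ * x * g) h; simpa [mul_assoc] using this)
    · rw [pow_one] at h
      exact hg (by simpa using congrArg (· * g) h)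
  haveI : Fact (Nat.Prime 2) := ⟨Nat.prime_two⟩
  obtain ⟨n, hn⟩ := SkewSectionPrime.two_mul_prime_dvd_card c u 2 hcc hu2 hu1 (hcen u)
    (SkewSectionPrime.ne_pow_of_nonnormal hc1 hcen hu2 hu1 hnn)
  exact exists_simple_degenerate_of_nonnormal_prime_order' e u 2 n hu2 hu1 hn hnn
    (SkewSectionPrime.count'_two n (by omega))

/-- **`p = 3`: `|G₀| ≥ 78` suffices** (`u³ = 1 ≠ u`, `⟨u⟩` not normal; gen 33: `84`).
[cite: Shimura1998, §6.2 Thm. 3, §8.2 Prop. 26 and §32.10] [cite: Gordon1999HodgeAVSurvey, Thm. 6.4 and §9.3] -/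
theorem exists_simple_degenerate_of_nonnormal_order_three' {G₀ : Type*} [Group G₀] [Fintype G₀] [DecidableEq G₀]
    (e : (K ≃ₐ[ℚ] K) ≃* G₀) (u : G₀) (hu3 : u ^ 3 = 1) (hu1 : u ≠ 1) (hnn : ∃ g : G₀, ∀ k < 3, g * u * g⁻¹ ≠ u ^ k)
    (hbig : 78 ≤ Fintype.card G₀) :
    ∃ (Φ : CMType K) (φ₀ : K →+* ℂ) (A : AbelianVariety ℂ) (ι : 𝓞 K →+* End A)
      (θ : K →+* Module.End ℂ (complexBetti A.X 1)),
      IsPrimitive (ℂ ≃+* ℂ) Φ.1 φ₀ ∧ ¬ IsNondegenerate Φ ∧ IsCMTypeRealisation Φ A ι θ ∧ A.IsSimple ∧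
      A.dim = Fintype.card G₀ / 2 ∧
      ∃ n p : ℕ, ∃ x : complexBetti (⨁ fun _ : Fin n => A).X (2 * p), IsRationalClass x ∧
        IsOfHodgeType (⨁ fun _ : Fin n => A).dim (⨁ fun _ : Fin n => A).X (2 * p) p p x ∧
        x ∉ divisorClassesSpan (⨁ fun _ : Fin n => A).X (⨁ fun _ : Fin n => A).dim p := by
  classical
  haveI : Fact (Nat.Prime 3) := ⟨Nat.prime_three⟩
  set c := e ((IsCMField.complexConj K).restrictScalars ℚ) with hc_def
  have hcc : c * c = 1 := model_complexConj_mul_self e rfl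
  have hc1 : c ≠ 1 := model_complexConj_ne_one e rfl
  have hcen : ∀ g : G₀, c * g = g * c := model_complexConj_comm e rfl
  obtain ⟨n, hn⟩ := SkewSectionPrime.two_mul_prime_dvd_card c u 3 hcc hu3 hu1 (hcen u)
    (SkewSectionPrime.ne_pow_of_nonnormal hc1 hcen hu3 hu1 hnn)
  exact exists_simple_degenerate_of_nonnormal_prime_order' e u 3 n hu3 hu1 hn hnn
    (SkewSectionPrime.count'_three n (by omega))

/-- **`p = 5`: `|G₀| ≥ 150` suffices** (`u⁵ = 1 ≠ u`, `⟨u⟩` not normal; gen 33: `170`).  Includes `|G₀| = 160 = 32·5`.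
[cite: Shimura1998, §6.2 Thm. 3, §8.2 Prop. 26 and §32.10] [cite: Gordon1999HodgeAVSurvey, Thm. 6.4 and §9.3] -/
theorem exists_simple_degenerate_of_nonnormal_order_five {G₀ : Type*} [Group G₀] [Fintype G₀] [DecidableEq G₀]
    (e : (K ≃ₐ[ℚ] K) ≃* G₀) (u : G₀) (hu5 : u ^ 5 = 1) (hu1 : u ≠ 1) (hnn : ∃ g : G₀, ∀ k < 5, g * u * g⁻¹ ≠ u ^ k)
    (hbig : 150 ≤ Fintype.card G₀) :
    ∃ (Φ : CMType K) (φ₀ : K →+* ℂ) (A : AbelianVariety ℂ) (ι : 𝓞 K →+* End A)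
      (θ : K →+* Module.End ℂ (complexBetti A.X 1)),
      IsPrimitive (ℂ ≃+* ℂ) Φ.1 φ₀ ∧ ¬ IsNondegenerate Φ ∧ IsCMTypeRealisation Φ A ι θ ∧ A.IsSimple ∧
      A.dim = Fintype.card G₀ / 2 ∧
      ∃ n p : ℕ, ∃ x : complexBetti (⨁ fun _ : Fin n => A).X (2 * p), IsRationalClass x ∧
        IsOfHodgeType (⨁ fun _ : Fin n => A).dim (⨁ fun _ : Fin n => A).X (2 * p) p p x ∧
        x ∉ divisorClassesSpan (⨁ fun _ : Fin n => A).X (⨁ fun _ : Fin n => A).dim p := by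
  classical
  haveI : Fact (Nat.Prime 5) := ⟨Nat.prime_five⟩
  set c := e ((IsCMField.complexConj K).restrictScalars ℚ) with hc_def
  have hcc : c * c = 1 := model_complexConj_mul_self e rfl
  have hc1 : c ≠ 1 := model_complexConj_ne_one e rfl
  have hcen : ∀ g : G₀, c * g = g * c := model_complexConj_comm e rfl
  obtain ⟨n, hn⟩ := SkewSectionPrime.two_mul_prime_dvd_card c u 5 hcc hu5 hu1 (hcen u)
    (SkewSectionPrime.ne_pow_of_nonnormal hc1 hcen hu5 hu1 hnn)
  exact exists_simple_degenerate_of_nonnormal_prime_order' e u 5 n hu5 hu1 hn hnn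
    (SkewSectionPrime.count'_five n (by omega))

/-- **`p = 7`: `|G₀| ≥ 210` suffices** (`u⁷ = 1 ≠ u`, `⟨u⟩` not normal; gen 33: `238`).  Includes `|G₀| = 224 = 32·7`.
[cite: Shimura1998, §6.2 Thm. 3, §8.2 Prop. 26 and §32.10] [cite: Gordon1999HodgeAVSurvey, Thm. 6.4 and §9.3] -/
theorem exists_simple_degenerate_of_nonnormal_order_seven {G₀ : Type*} [Group G₀] [Fintype G₀] [DecidableEq G₀]
    (e : (K ≃ₐ[ℚ] K) ≃* G₀) (u : G₀) (hu7 : u ^ 7 = 1) (hu1 : u ≠ 1) (hnn : ∃ g : G₀, ∀ k < 7, g * u * g⁻¹ ≠ u ^ k)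
    (hbig : 210 ≤ Fintype.card G₀) :
    ∃ (Φ : CMType K) (φ₀ : K →+* ℂ) (A : AbelianVariety ℂ) (ι : 𝓞 K →+* End A)
      (θ : K →+* Module.End ℂ (complexBetti A.X 1)),
      IsPrimitive (ℂ ≃+* ℂ) Φ.1 φ₀ ∧ ¬ IsNondegenerate Φ ∧ IsCMTypeRealisation Φ A ι θ ∧ A.IsSimple ∧
      A.dim = Fintype.card G₀ / 2 ∧
      ∃ n p : ℕ, ∃ x : complexBetti (⨁ fun _ : Fin n => A).X (2 * p), IsRationalClass x ∧
        IsOfHodgeType (⨁ fun _ : Fin n => A).dim (⨁ fun _ : Fin n => A).X (2 * p) p p x ∧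
        x ∉ divisorClassesSpan (⨁ fun _ : Fin n => A).X (⨁ fun _ : Fin n => A).dim p := by
  classical
  haveI : Fact (Nat.Prime 7) := ⟨by norm_num⟩
  set c := e ((IsCMField.complexConj K).restrictScalars ℚ) with hc_def
  have hcc : c * c = 1 := model_complexConj_mul_self e rfl
  have hc1 : c ≠ 1 := model_complexConj_ne_one e rfl
  have hcen : ∀ g : G₀, c * g = g * c := model_complexConj_comm e rfl
  obtain ⟨n, hn⟩ := SkewSectionPrime.two_mul_prime_dvd_card c u 7 hcc hu7 hu1 (hcen u)
    (SkewSectionPrime.ne_pow_of_nonnormal hc1 hcen hu7 hu1 hnn)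
  exact exists_simple_degenerate_of_nonnormal_prime_order' e u 7 n hu7 hu1 hn hnn
    (SkewSectionPrime.count'_seven n (by omega))

/-! ## §2 On `Gal(K/ℚ)` itself -/

/-- **… on `Gal(K/ℚ)` itself** (REFINED count): `[K:ℚ] = 2pn`, `σᵖ = 1 ≠ σ` with `⟨σ⟩` NOT normal, and
`(2pn - 1 - m(p-1))·2^(n/2) + m(p-1)·2^((n + (p-1)(n/m))/p) < 2^n` for all `m ≥ 2` dividing `n` ⟹ `K` carries a SIMPLE DEGENERATE
abelian variety of dimension `[K:ℚ]/2`. [cite: Shimura1998, §6.2 Thm. 3, §8.2 Prop. 26 and §32.10] [cite: Gordon1999HodgeAVSurvey, Thm. 6.4 and §9.3] -/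
theorem exists_simple_degenerate_of_nonnormal_prime_order_gal' (σ : K ≃ₐ[ℚ] K) (p n : ℕ) [Fact p.Prime]
    (hσp : σ ^ p = 1) (hσ1 : σ ≠ 1) (hnn : ∃ τ : K ≃ₐ[ℚ] K, ∀ k < p, τ * σ * τ⁻¹ ≠ σ ^ k)
    (hdeg : Module.finrank ℚ K = 2 * p * n)
    (hcount : ∀ m, 2 ≤ m → m ∣ n →
      (2 * p * n - 1 - m * (p - 1)) * 2 ^ (n / 2) + m * (p - 1) * 2 ^ ((n + (p - 1) * (n / m)) / p) < 2 ^ n) :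
    ∃ (Φ : CMType K) (φ₀ : K →+* ℂ) (A : AbelianVariety ℂ) (ι : 𝓞 K →+* End A)
      (θ : K →+* Module.End ℂ (complexBetti A.X 1)),
      IsPrimitive (ℂ ≃+* ℂ) Φ.1 φ₀ ∧ ¬ IsNondegenerate Φ ∧ IsCMTypeRealisation Φ A ι θ ∧ A.IsSimple ∧
      A.dim = Module.finrank ℚ K / 2 ∧
      ∃ n p : ℕ, ∃ x : complexBetti (⨁ fun _ : Fin n => A).X (2 * p), IsRationalClass x ∧
        IsOfHodgeType (⨁ fun _ : Fin n => A).dim (⨁ fun _ : Fin n => A).X (2 * p) p p x ∧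
        x ∉ divisorClassesSpan (⨁ fun _ : Fin n => A).X (⨁ fun _ : Fin n => A).dim p := by
  classical
  have hcard : Fintype.card (K ≃ₐ[ℚ] K) = 2 * p * n := by
    rw [card_model_eq_finrank (MulEquiv.refl (K ≃ₐ[ℚ] K))]; exact hdeg
  obtain ⟨Φ, φ₀, A, ι, θ, H1, H2, H3, H4, H5, H6⟩ :=
    exists_simple_degenerate_of_nonnormal_prime_order' (MulEquiv.refl (K ≃ₐ[ℚ] K)) σ p n hσp hσ1 hcard hnn hcount
  refine ⟨Φ, φ₀, A, ι, θ, H1, H2, H3, H4, ?_, H6⟩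
  rw [H5, card_model_eq_finrank (MulEquiv.refl (K ≃ₐ[ℚ] K))]

/-- **… on `Gal(K/ℚ)` itself, `p ∈ {2, 3, 5, 7}` from the degree alone**: `[K:ℚ] ≥ 44` (`p = 2`), `≥ 78` (`p = 3`), `≥ 150` (`p = 5`),
`≥ 210` (`p = 7`), and `σ` of order `p` with `⟨σ⟩` NOT normal ⟹ `K` carries a SIMPLE DEGENERATE abelian variety of dimension `[K:ℚ]/2`.
[cite: Shimura1998, §6.2 Thm. 3, §8.2 Prop. 26 and §32.10] [cite: Gordon1999HodgeAVSurvey, Thm. 6.4 and §9.3] -/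
theorem exists_simple_degenerate_of_nonnormal_prime_order_of_card_ge_gal (σ : K ≃ₐ[ℚ] K) (p : ℕ)
    (hp : (p = 2 ∧ 44 ≤ Module.finrank ℚ K) ∨ (p = 3 ∧ 78 ≤ Module.finrank ℚ K) ∨ (p = 5 ∧ 150 ≤ Module.finrank ℚ K) ∨
      (p = 7 ∧ 210 ≤ Module.finrank ℚ K))
    (hσp : σ ^ p = 1) (hσ1 : σ ≠ 1) (hnn : ∃ τ : K ≃ₐ[ℚ] K, ∀ k < p, τ * σ * τ⁻¹ ≠ σ ^ k) :
    ∃ (Φ : CMType K) (φ₀ : K →+* ℂ) (A : AbelianVariety ℂ) (ι : 𝓞 K →+* End A)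
      (θ : K →+* Module.End ℂ (complexBetti A.X 1)),
      IsPrimitive (ℂ ≃+* ℂ) Φ.1 φ₀ ∧ ¬ IsNondegenerate Φ ∧ IsCMTypeRealisation Φ A ι θ ∧ A.IsSimple ∧
      A.dim = Module.finrank ℚ K / 2 ∧
      ∃ n p : ℕ, ∃ x : complexBetti (⨁ fun _ : Fin n => A).X (2 * p), IsRationalClass x ∧
        IsOfHodgeType (⨁ fun _ : Fin n => A).dim (⨁ fun _ : Fin n => A).X (2 * p) p p x ∧
        x ∉ divisorClassesSpan (⨁ fun _ : Fin n => A).X (⨁ fun _ : Fin n => A).dim p := by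
  classical
  have hcardK : Fintype.card (K ≃ₐ[ℚ] K) = Module.finrank ℚ K := card_model_eq_finrank (MulEquiv.refl (K ≃ₐ[ℚ] K))
  have key : ∃ (Φ : CMType K) (φ₀ : K →+* ℂ) (A : AbelianVariety ℂ) (ι : 𝓞 K →+* End A)
      (θ : K →+* Module.End ℂ (complexBetti A.X 1)),
      IsPrimitive (ℂ ≃+* ℂ) Φ.1 φ₀ ∧ ¬ IsNondegenerate Φ ∧ IsCMTypeRealisation Φ A ι θ ∧ A.IsSimple ∧
      A.dim = Fintype.card (K ≃ₐ[ℚ] K) / 2 ∧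
      ∃ n p : ℕ, ∃ x : complexBetti (⨁ fun _ : Fin n => A).X (2 * p), IsRationalClass x ∧
        IsOfHodgeType (⨁ fun _ : Fin n => A).dim (⨁ fun _ : Fin n => A).X (2 * p) p p x ∧
        x ∉ divisorClassesSpan (⨁ fun _ : Fin n => A).X (⨁ fun _ : Fin n => A).dim p := by
    rcases hp with ⟨rfl, h⟩ | ⟨rfl, h⟩ | ⟨rfl, h⟩ | ⟨rfl, h⟩
    · obtain ⟨τ, hτ⟩ := hnn
      refine exists_simple_degenerate_of_noncentral_involution_of_card_ge' (MulEquiv.refl (K ≃ₐ[ℚ] K)) σ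
        (by rw [← pow_two, hσp]) ⟨τ, fun h' => hτ 1 (by norm_num) ?_⟩ (by rw [hcardK]; exact h)
      rw [pow_one, h', mul_inv_cancel_right]
    · exact exists_simple_degenerate_of_nonnormal_order_three' (MulEquiv.refl (K ≃ₐ[ℚ] K)) σ hσp hσ1 hnn (by rw [hcardK]; exact h)
    · exact exists_simple_degenerate_of_nonnormal_order_five (MulEquiv.refl (K ≃ₐ[ℚ] K)) σ hσp hσ1 hnn (by rw [hcardK]; exact h)
    · exact exists_simple_degenerate_of_nonnormal_order_seven (MulEquiv.refl (K ≃ₐ[ℚ] K)) σ hσp hσ1 hnn (by rw [hcardK]; exact h)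
  obtain ⟨Φ, φ₀, A, ι, θ, H1, H2, H3, H4, H5, H6⟩ := key
  exact ⟨Φ, φ₀, A, ι, θ, H1, H2, H3, H4, by rw [H5, hcardK], H6⟩

/-! ## §3 GOOD ⟹ every subgroup of prime order is normal -/

/-- **GOOD Galois CM fields have every prime-order subgroup of the Galois group NORMAL** (REFINED count: `[K:ℚ] = 2pn` and
`(2pn - 1 - m(p-1))·2^(n/2) + m(p-1)·2^((n + (p-1)(n/m))/p) < 2^n` for `m ≥ 2` dividing `n`): if every primitive CM type of `K` is
nondegenerate, then for `σᵖ = 1 ≠ σ` and every `τ`, `τ σ τ⁻¹` is a power of `σ`. [cite: Shimura1998, §8.2 Prop. 26 and §32.10] -/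
theorem exists_conj_eq_pow_of_forall_isNondegenerate' (p n : ℕ) [Fact p.Prime] (hdeg : Module.finrank ℚ K = 2 * p * n)
    (hcount : ∀ m, 2 ≤ m → m ∣ n →
      (2 * p * n - 1 - m * (p - 1)) * 2 ^ (n / 2) + m * (p - 1) * 2 ^ ((n + (p - 1) * (n / m)) / p) < 2 ^ n)
    (hgood : ∀ (Φ : CMType K) (φ : K →+* ℂ), IsPrimitive (ℂ ≃+* ℂ) Φ.1 φ → IsNondegenerate Φ)
    (σ : K ≃ₐ[ℚ] K) (hσp : σ ^ p = 1) (hσ1 : σ ≠ 1) (τ : K ≃ₐ[ℚ] K) : ∃ k < p, τ * σ * τ⁻¹ = σ ^ k := by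
  by_contra h
  push Not at h
  obtain ⟨Φ, φ₀, A, ι, θ, H1, H2, -⟩ :=
    exists_simple_degenerate_of_nonnormal_prime_order_gal' σ p n hσp hσ1 ⟨τ, h⟩ hdeg hcount
  exact H2 (hgood Φ φ₀ H1)

/-- **GOOD Galois CM fields of degree `≥ 44 / 78 / 150 / 210` have every subgroup of order `2 / 3 / 5 / 7` of the Galois group NORMAL**:
if every primitive CM type of `K` is nondegenerate, then for `σ` of order `p ∈ {2, 3, 5, 7}` and every `τ`, `τ σ τ⁻¹` is a power of `σ`.
[cite: Shimura1998, §8.2 Prop. 26 and §32.10] -/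
theorem exists_conj_eq_pow_of_forall_isNondegenerate_of_card_ge (p : ℕ)
    (hp : (p = 2 ∧ 44 ≤ Module.finrank ℚ K) ∨ (p = 3 ∧ 78 ≤ Module.finrank ℚ K) ∨ (p = 5 ∧ 150 ≤ Module.finrank ℚ K) ∨
      (p = 7 ∧ 210 ≤ Module.finrank ℚ K))
    (hgood : ∀ (Φ : CMType K) (φ : K →+* ℂ), IsPrimitive (ℂ ≃+* ℂ) Φ.1 φ → IsNondegenerate Φ)
    (σ : K ≃ₐ[ℚ] K) (hσp : σ ^ p = 1) (hσ1 : σ ≠ 1) (τ : K ≃ₐ[ℚ] K) : ∃ k < p, τ * σ * τ⁻¹ = σ ^ k := by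
  by_contra h
  push Not at h
  obtain ⟨Φ, φ₀, A, ι, θ, H1, H2, -⟩ :=
    exists_simple_degenerate_of_nonnormal_prime_order_of_card_ge_gal σ p hp hσp hσ1 ⟨τ, h⟩
  exact H2 (hgood Φ φ₀ H1)

/-- **GOOD Galois CM fields of degree `≥ 44` have all involutions of the Galois group central** (gen 32: `64`; gen 33: `52`).
[cite: Shimura1998, §8.2 Prop. 26 and §32.10] -/
theorem commute_of_involution_of_forall_isNondegenerate_of_card_ge (hdeg : 44 ≤ Module.finrank ℚ K)
    (hgood : ∀ (Φ : CMType K) (φ : K →+* ℂ), IsPrimitive (ℂ ≃+* ℂ) Φ.1 φ → IsNondegenerate Φ)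
    (σ : K ≃ₐ[ℚ] K) (hσ : σ * σ = 1) (τ : K ≃ₐ[ℚ] K) : τ * σ = σ * τ := by
  classical
  by_contra h
  have hbig : 44 ≤ Fintype.card (K ≃ₐ[ℚ] K) := by rw [card_model_eq_finrank (MulEquiv.refl (K ≃ₐ[ℚ] K))]; exact hdeg
  obtain ⟨Φ, φ₀, A, ι, θ, H1, H2, -⟩ :=
    exists_simple_degenerate_of_noncentral_involution_of_card_ge' (MulEquiv.refl (K ≃ₐ[ℚ] K)) σ hσ ⟨τ, h⟩ hbig
  exact H2 (hgood Φ φ₀ H1)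

/-- **In a GOOD Galois CM field of degree `≥ 150` (resp. `≥ 210`), the elements of order `5` (resp. `7`) of the Galois group COMMUTE
pairwise** (their cyclic groups are normal and normalise each other: `SkewSectionPrime.commute_of_conj_eq_pow`); likewise order `3`
from degree `78` and order `2` from degree `44`. [cite: Shimura1998, §8.2 Prop. 26 and §32.10] -/
theorem commute_of_prime_order_of_forall_isNondegenerate_of_card_ge (p : ℕ)
    (hp : (p = 2 ∧ 44 ≤ Module.finrank ℚ K) ∨ (p = 3 ∧ 78 ≤ Module.finrank ℚ K) ∨ (p = 5 ∧ 150 ≤ Module.finrank ℚ K) ∨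
      (p = 7 ∧ 210 ≤ Module.finrank ℚ K))
    (hgood : ∀ (Φ : CMType K) (φ : K →+* ℂ), IsPrimitive (ℂ ≃+* ℂ) Φ.1 φ → IsNondegenerate Φ)
    (σ τ : K ≃ₐ[ℚ] K) (hσp : σ ^ p = 1) (hτp : τ ^ p = 1) : σ * τ = τ * σ := by
  classical
  have hpp : p.Prime := by
    rcases hp with ⟨rfl, -⟩ | ⟨rfl, -⟩ | ⟨rfl, -⟩ | ⟨rfl, -⟩ <;> norm_num
  haveI : Fact p.Prime := ⟨hpp⟩
  by_cases hσ1 : σ = 1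
  · rw [hσ1, one_mul, mul_one]
  by_cases hτ1 : τ = 1
  · rw [hτ1, one_mul, mul_one]
  obtain ⟨k, -, hk⟩ := exists_conj_eq_pow_of_forall_isNondegenerate_of_card_ge p hp hgood σ hσp hσ1 τ
  obtain ⟨l, -, hl⟩ := exists_conj_eq_pow_of_forall_isNondegenerate_of_card_ge p hp hgood τ hτp hτ1 σ
  exact SkewSectionPrime.commute_of_conj_eq_pow hσp hτp ⟨k, hk⟩ ⟨l, hl⟩

end Summit.HodgeConjecture.CorCM.GaloisModels

end
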